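import Summits.NavierStokesRegularity.NavierStokesRegularity.Theorems.ScenarioCensusRowF1EquilibriumKill
import Summits.NavierStokesRegularity.NavierStokesRegularity.Theorems.ScenarioCensusRowF1FrozenTop
import HarnessLib

/-!
# LINE «equilibrium-top» port, part 3/4: §6 the transfer — fast points, the clocks, the joint transfer, analytic density (transfer lemmas BY NAME)

Re-homed for the scenario census (typer seat ns-census-typer-1 g8; the cells F1eqq / F1bnq and the o-forms F1eq / F1bn are MEMBERS OF RECORD «DECIDED IN KERNEL IN FILES» of
row F1 since census v1.71 (critic idea-crit-3 PASS; ref ns-census-ref g8 PRE-CHECK ✓; lead-presearch label); this port makes them TREE-decided): VERBATIM PORT of ns-idea-3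
LINE 19 «equilibrium-top», `pub/ideators/ns-idea-3/lines/equilibrium-top/line-equilibrium-top.lean` sha16 a530d660993acd54 (1664 l., lean check rc 0, 0 sorry), split
for the 400-line rule into `ScenarioCensusRowF1Equilibrium` (§1–§2) → `…EquilibriumKill` (§3–§5) → `…EquilibriumTransfer` (§6) → `…EquilibriumTop` (§7 + census KEYS).
Lean text VERBATIM in namespace `…Theorems.ScenarioCensus.EquilibriumTop` (the line's `…Cruxes.ScenarioCensusRowF1.EquilibriumTopLine` re-homed); port edits:
`@[conjecture]` on the residual `DriveDefectSlack` (≡ `ScenarioCensus.Row_F1`, OPEN), one-line docstrings added where missing (gate lint); the lemmas the line shares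
VERBATIM with the landed inviscid-top / frozen-top / columnar-top / stretched-top ports — including the §4 weak time-rigidity chain `cp` … `eq_zero_of_frozenVorticity`,
which the frozen-top port carries verbatim (and with it the one use of `Literature.Analysis.FunctionSpaces.WeakTimeDerivativeClassical`) — are taken BY NAME (listed
below); the line's direct WTDC import is therefore not needed here.  Statements untouched.

No census VALUE is moved here (row F1 stays OPEN-WITH-LINE; the members become TREE-decided by name); NS regularity is NOT proved; `Row_F1` is untouched
(zero movement, `driveDefectSlack_iff_rowF1`); no summit statement is proved by this file. Lemmas that restate already-landed tree declarations are taken BY NAME (gate lint `dedup.landed`): `fderiv_smul_stPull_apply` = `InviscidTop.fderiv_smul_stPull_apply`, `fderiv_smul_stPull` = `InviscidTop.fderiv_smul_stPull`, `fderiv_fderiv_smul_stPull` = `InviscidTop.fderiv_fderiv_smul_stPull`, `fderiv_fderiv_zoom` = `InviscidTop.fderiv_fderiv_zoom`, `tendsto_clm_of_tendsto_apply` = `InviscidTop.tendsto_clm_of_tendsto_apply`, `tendsto_fderiv_fderiv_apply_of_bound` = `InviscidTop.tendsto_fderiv_fderiv_apply_of_bound`, `tendsto_fderiv_fderiv_of_bound`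 = `InviscidTop.tendsto_fderiv_fderiv_of_bound`, `tendsto_fderiv_fderiv_of_typeI_seq_Ioo` = `InviscidTop.tendsto_fderiv_fderiv_of_typeI_seq_Ioo`, `tendsto_fderiv_fderiv_of_isTypeIAncientMild_seq` = `InviscidTop.tendsto_fderiv_fderiv_of_isTypeIAncientMild_seq`, `cp` = `FrozenTop.cp`, `cp_isTest` = `FrozenTop.cp_isTest`, `cp_isDivFree` = `FrozenTop.cp_isDivFree`, `pairing_eq_of_weakEquilibrium` = `FrozenTop.pairing_eq_of_weakEquilibrium`, `slice_sub_const_of_pairing_eq` = `FrozenTop.slice_sub_const_of_pairing_eq`, `eq_zero_of_increments_const` = `FrozenTop.eq_zero_of_increments_const`, `eq_zero_of_weakEquilibrium` = `FrozenTop.eq_zero_of_weakEquilibrium`, `eq_zero_of_frozenVorticity` = `FrozenTop.eq_zero_of_frozenVorticity`, `tendsto_physicalTime` = `ColumnarTop.tendsto_physicalTime`, `eventually_fast` = `ColumnarTop.eventually_fast`, `sqrt_timeLag` = `StretchedTop.sqrt_timeLag`, `forall_of_forall_ne_zero` = `StretchedTop.forall_of_forall_ne_zero`, `radius_eq` = `FrozenTop.radius_eq`,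 `sing_of_not_bounded` = `InviscidTop.sing_of_not_bounded`, `exists_singularZoom_package₂` = `InviscidTop.exists_singularZoom_package₂`, `clock₂_eq` = `InviscidTop.clock₂_eq`.
-/

-- the summit and its single problem share the name `NavierStokesRegularity` (D-0017 nested layout)
set_option linter.dupNamespace false

noncomputable section

open MeasureTheory Set Function Filter TopologicalSpace Metric
open scoped Topology NNReal ENNReal InnerProductSpace RealInnerProductSpace Laplacian

namespace Summit.NavierStokesRegularity.NavierStokesRegularity.Theorems.ScenarioCensus.EquilibriumTop

open Literature.Analysis Literature.Analysis.FluidPDE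
open Summit.NavierStokesRegularity.NavierStokesRegularity.Theorems

/-! ## §6 The transfer: fast points, the clocks, the joint transfer, analytic density -/

-- `tendsto_physicalTime`: the line restates the tree's `ColumnarTop.tendsto_physicalTime`; taken BY NAME (gate lint dedup.landed).

-- `sqrt_timeLag`: the line restates the tree's `StretchedTop.sqrt_timeLag`; taken BY NAME (gate lint dedup.landed).

-- `eventually_fast`: the line restates the tree's `ColumnarTop.eventually_fast`; taken BY NAME (gate lint dedup.landed).

-- `clock₂_eq`: the line restates the tree's `InviscidTop.clock₂_eq`; taken BY NAME (gate lint dedup.landed).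

-- `radius_eq`: the line restates the tree's `FrozenTop.radius_eq`; taken BY NAME (gate lint dedup.landed).

/-- **The cube clock identity**: `(c R)³ (−t)^{3/2} = ν · √ν (T − τ_j)^{3/2}` (the joint zoom weight at
`a = c R` is `ν` times the second-order clock). -/
theorem cube_clock_eq {T ν t α β R : ℝ} (hν : 0 < ν) (hα : 0 < α) (hβ : 0 < β) (hαR : α * R = β)
    (hαν : α * Real.sqrt ν = Real.sqrt β) (ht : t < 0) {c : ℕ → ℝ} (hcpos : ∀ j, 0 < c j) (j : ℕ) :
    (c j * R) ^ 3 * ((-t) * Real.sqrt (-t)) = ν * clock₂ ν T (T + c j ^ 2 * β * t) := by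
  have hce : c j * α * (c j * R) * (c j * R) * ((-t) * Real.sqrt (-t)) = clock₂ ν T (T + c j ^ 2 * β * t) :=
    InviscidTop.clock₂_eq hα hβ hαR hαν ht hcpos j  -- (BY NAME; restated locally so that `rw` sees this line's `clock₂`)
  rw [← hce]
  have hR := FrozenTop.radius_eq hν hα hβ hαR hαν
  calc (c j * R) ^ 3 * ((-t) * Real.sqrt (-t)) = c j ^ 3 * R * R * R * ((-t) * Real.sqrt (-t)) := by ring
    _ = c j ^ 3 * (ν * α) * R * R * ((-t) * Real.sqrt (-t)) := by rw [← hR]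
    _ = ν * (c j * α * (c j * R) * (c j * R) * ((-t) * Real.sqrt (-t))) := by ring

/-- **JOINT TRANSFER**: for a continuous read-out `Rd(v, L, H)`, homogeneous of weight 3 under `(a, a², a³)`, the
physical bound «`ν clock₂ Rd(u/ν, ∇u/ν, ∇²u/ν) ≤ ε` at the `Λ t'`-fast points, eventually» passes to
«`(−t)^{3/2} Rd(W, ∇W, ∇²W)(t, y) ≤ ε` at every `y` with `W(t, y) ≠ 0`». -/
theorem joint_transfer {T ν ε : ℝ} {u : ℝ → E3 → E3} {x₀ : E3} {α β R : ℝ} {c : ℕ → ℝ}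
    {W : ℝ → E3 → E3} (hν : 0 < ν)
    (hα : 0 < α) (hβ : 0 < β) (hαR : α * R = β) (hαν : α * Real.sqrt ν = Real.sqrt β)
    (hcpos : ∀ j, 0 < c j) (hclim : Tendsto c atTop (𝓝 0))
    (hpt : ∀ t < 0, ∀ y : E3,
      Tendsto (fun j => (c j * α) • u (T + c j ^ 2 * β * t) (x₀ + (c j * R) • y)) atTop (𝓝 (W t y)))
    (hgrad : ∀ t < 0, ∀ y : E3,
      Tendsto (fun j => (c j * α * (c j * R)) • fderiv ℝ (u (T + c j ^ 2 * β * t)) (x₀ + (c j * R) • y))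
        atTop (𝓝 (fderiv ℝ (W t) y)))
    (hhess : ∀ t < 0, ∀ y : E3,
      Tendsto (fun j => (c j * α * (c j * R) * (c j * R)) •
          fderiv ℝ (fderiv ℝ (u (T + c j ^ 2 * β * t))) (x₀ + (c j * R) • y))
        atTop (𝓝 (fderiv ℝ (fderiv ℝ (W t)) y)))
    {Rd : E3 → (E3 →L[ℝ] E3) → Hess → ℝ}
    (hRc : Continuous fun q : E3 × (E3 →L[ℝ] E3) × Hess => Rd q.1 q.2.1 q.2.2)
    (hRh : ∀ a : ℝ, 0 < a → ∀ v L H, Rd (a • v) (a ^ 2 • L) (a ^ 3 • H) = a ^ 3 * Rd v L H)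
    {Λ : ℝ → ℝ} (hΛ : IsSubcriticalLevel T Λ) (hH : HasJointDefectAt T Λ ν ε Rd u) :
    ∀ t < 0, ∀ y, W t y ≠ 0 →
      (-t) * Real.sqrt (-t) * Rd (W t y) (fderiv ℝ (W t) y) (fderiv ℝ (fderiv ℝ (W t)) y) ≤ ε := by
  intro t ht y hne
  have hj := (hpt t ht y).prodMk_nhds ((hgrad t ht y).prodMk_nhds (hhess t ht y))
  have hlim := ((hRc.tendsto _).comp hj).const_mul ((-t) * Real.sqrt (-t))
  have hfast := ColumnarTop.eventually_fast hα hβ hcpos hclim hpt hΛ ht hne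
  have hτ := ColumnarTop.tendsto_physicalTime (T := T) hβ ht hcpos hclim
  have hR := FrozenTop.radius_eq hν hα hβ hαR hαν
  refine le_of_tendsto hlim ?_
  filter_upwards [hfast, hτ.eventually hH] with j hj1 hj2
  have hb := hj2 _ hj1
  have ha : 0 < c j * R := by rw [hR]; exact mul_pos (hcpos j) (mul_pos hν hα)
  -- the zoom triple is `(a • u/ν, a² • ∇u/ν, a³ • ∇²u/ν)` with `a = c_j R`
  have e1 : c j * α = (c j * R) * ν⁻¹ := by rw [hR]; field_simp
  have e2 : c j * α * (c j * R) = (c j * R) ^ 2 * ν⁻¹ := by rw [hR]; field_simp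
  have e3 : c j * α * (c j * R) * (c j * R) = (c j * R) ^ 3 * ν⁻¹ := by rw [hR]; field_simp
  show (-t) * Real.sqrt (-t) *
      Rd ((c j * α) • u (T + c j ^ 2 * β * t) (x₀ + (c j * R) • y))
        ((c j * α * (c j * R)) • fderiv ℝ (u (T + c j ^ 2 * β * t)) (x₀ + (c j * R) • y))
        ((c j * α * (c j * R) * (c j * R)) •
          fderiv ℝ (fderiv ℝ (u (T + c j ^ 2 * β * t))) (x₀ + (c j * R) • y)) ≤ ε
  rw [e3, e2, e1, mul_smul (c j * R) ν⁻¹, mul_smul ((c j * R) ^ 2) ν⁻¹, mul_smul ((c j * R) ^ 3) ν⁻¹,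
    hRh _ ha, ← mul_assoc, mul_comm ((-t) * Real.sqrt (-t)),
    cube_clock_eq hν hα hβ hαR hαν ht hcpos j]
  exact hb

-- `forall_of_forall_ne_zero`: the line restates the tree's `StretchedTop.forall_of_forall_ne_zero`; taken BY NAME (gate lint dedup.landed).

/-- **Joint conditions globalise**: a closed condition on `(W, ∇W, ∇²W)(s, ·)` holding on `{W(s, ·) ≠ 0}` and at
`(0, 0, 0)` holds everywhere (analytic density on nontrivial slices; the triple vanishes on trivial ones). -/
theorem jointCond_everywhere {C : ℝ} {W : ℝ → E3 → E3} (hW : IsTypeIAncientMild C W)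
    {P : ℝ → E3 × (E3 →L[ℝ] E3) × Hess → Prop} (hPc : ∀ w : ℝ, IsClosed {q | P w q})
    (hP0 : ∀ w : ℝ, P w (0, 0, 0))
    (h : ∀ s < 0, ∀ y, W s y ≠ 0 → P (-s) (W s y, fderiv ℝ (W s) y, fderiv ℝ (fderiv ℝ (W s)) y)) :
    ∀ s < 0, ∀ y, P (-s) (W s y, fderiv ℝ (W s) y, fderiv ℝ (fderiv ℝ (W s)) y) := by
  intro s hs y
  by_cases hnt : ∃ z, W s z ≠ 0
  · have hc0 : Continuous (W s) := hW.continuous_slice hs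
    have hc1 : Continuous fun y => fderiv ℝ (W s) y := (hW.contDiff_slice hs).continuous_fderiv (by simp)
    have hc2 : Continuous fun y => fderiv ℝ (fderiv ℝ (W s)) y :=
      ((hW.contDiff_slice hs).fderiv_right (m := 1) (by norm_cast)).continuous_fderiv (by norm_num)
    have hS : IsClosed {y : E3 | P (-s) (W s y, fderiv ℝ (W s) y, fderiv ℝ (fderiv ℝ (W s)) y)} :=
      (hPc (-s)).preimage (hc0.prodMk (hc1.prodMk hc2))
    exact StretchedTop.forall_of_forall_ne_zero hW hs hS (fun y hy => h s hs y hy) hnt y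
  · push Not at hnt
    have h0 : W s = fun _ => (0 : E3) := funext hnt
    have h1 : fderiv ℝ (W s) = fun _ => (0 : E3 →L[ℝ] E3) := by
      funext z; rw [h0, fderiv_const_apply]
    have h2 : fderiv ℝ (fderiv ℝ (W s)) y = 0 := by rw [h1, fderiv_const_apply]
    rw [h2, h1, hnt y]
    exact hP0 (-s)

/-- **The full joint transfer**: an ε-joint-defect of a nonnegative, weight-3 homogeneous, continuous read-out on the
top passes to `(−s)^{3/2} Rd(W, ∇W, ∇²W)(s, y) ≤ ε` at EVERY point of the open past of the zoom limit. -/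
theorem joint_transfer_everywhere {T ν ε M : ℝ} {u : ℝ → E3 → E3} {x₀ : E3} {α β R : ℝ} {c : ℕ → ℝ}
    {W : ℝ → E3 → E3} (hW : IsTypeIAncientMild M W) (hν : 0 < ν)
    (hα : 0 < α) (hβ : 0 < β) (hαR : α * R = β) (hαν : α * Real.sqrt ν = Real.sqrt β)
    (hcpos : ∀ j, 0 < c j) (hclim : Tendsto c atTop (𝓝 0))
    (hpt : ∀ t < 0, ∀ y : E3,
      Tendsto (fun j => (c j * α) • u (T + c j ^ 2 * β * t) (x₀ + (c j * R) • y)) atTop (𝓝 (W t y)))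
    (hgrad : ∀ t < 0, ∀ y : E3,
      Tendsto (fun j => (c j * α * (c j * R)) • fderiv ℝ (u (T + c j ^ 2 * β * t)) (x₀ + (c j * R) • y))
        atTop (𝓝 (fderiv ℝ (W t) y)))
    (hhess : ∀ t < 0, ∀ y : E3,
      Tendsto (fun j => (c j * α * (c j * R) * (c j * R)) •
          fderiv ℝ (fderiv ℝ (u (T + c j ^ 2 * β * t))) (x₀ + (c j * R) • y))
        atTop (𝓝 (fderiv ℝ (fderiv ℝ (W t)) y)))
    {Rd : E3 → (E3 →L[ℝ] E3) → Hess → ℝ}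
    (hRc : Continuous fun q : E3 × (E3 →L[ℝ] E3) × Hess => Rd q.1 q.2.1 q.2.2)
    (hRh : ∀ a : ℝ, 0 < a → ∀ v L H, Rd (a • v) (a ^ 2 • L) (a ^ 3 • H) = a ^ 3 * Rd v L H)
    (hR0 : Rd 0 0 0 = 0) (hε : 0 ≤ ε) {Λ : ℝ → ℝ} (hΛ : IsSubcriticalLevel T Λ)
    (hH : HasJointDefectAt T Λ ν ε Rd u) :
    ∀ s < 0, ∀ y,
      (-s) * Real.sqrt (-s) * Rd (W s y) (fderiv ℝ (W s) y) (fderiv ℝ (fderiv ℝ (W s)) y) ≤ ε := by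
  have hPc : ∀ w : ℝ, IsClosed {q : E3 × (E3 →L[ℝ] E3) × Hess | w * Real.sqrt w * Rd q.1 q.2.1 q.2.2 ≤ ε} :=
    fun w => isClosed_le (continuous_const.mul hRc) continuous_const
  exact jointCond_everywhere hW (P := fun w q => w * Real.sqrt w * Rd q.1 q.2.1 q.2.2 ≤ ε) hPc
    (fun w => by show w * Real.sqrt w * Rd 0 0 0 ≤ ε; rw [hR0, mul_zero]; exact hε)
    (joint_transfer hν hα hβ hαR hαν hcpos hclim hpt hgrad hhess hRc hRh hΛ hH)

end Summit.NavierStokesRegularity.NavierStokesRegularity.Theorems.ScenarioCensus.EquilibriumTop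

end
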